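import Summits.CriticalPhenomena.SAWScalingLimit.Theses.SAWBrickWallHomotopy
import Summits.CriticalPhenomena.SAWScalingLimit.Theses.SAWHexUniversality
import Summits.CriticalPhenomena.SAWScalingLimit.Theorems.SAWMassiveIsingTiltHexEndpointApproxExists
import Literature.Probability.RandomPlanarGeometry.ZoomFlow
import HarnessLib

/-!
# `ModulusUniversality` from `LatticeUniversality` (the case `Φ = id`)

Helper file (`--supports stmt-CriticalPhenomena-5790`, registered sub-goal
`modulusUniversality_of_latticeUniversality`) of the line `birth` / `registered` for the crux
`SAWBrickWallHomotopy.ModulusUniversality`.  The route header's remark "Proved elsewhere: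
`SAWHexUniversality.LatticeUniversality` gives `ModulusUniversality` with `Φ = id` (r3 closes for free)"
made a kernel-checked edge between the two routes: the plain universality statement (U) of route
`SAWHexUniversality` (item `LatticeUniversality`: for EVERY Dobrushin domain, every `ℤ²` endpoint
approximation AND every hexagonal endpoint approximation of the same domain, the two critical SAW
laws merge on bounded continuous test functions) implies the linear-modulus universality of this
route with `r₁ = r₂ = 1`: then `Φ = id` (`Homeomorph.ext`), `D.map Φ.symm = D`
(`MarkedDomain.map_refl`, tree), `CurveClass.map id = id`, and a hexagonal endpoint
approximation of `D` exists (`HexEndpointApprox.exists_isEmbEndpointApprox`, landed).  Nothing is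
closed: `LatticeUniversality` is itself open (and, by `z2Tight_of_modulusUniversality`, at least
tightness-hard).
-/

noncomputable section

open MeasureTheory Filter Topology
open Literature.Probability.LatticeModels
open Literature.Probability.RandomPlanarGeometry

namespace Summit.CriticalPhenomena.SAWScalingLimit.Cruxes.ModulusUniversality.Birth

/-- Push-forward of curve classes along the identity map is the identity. [folklore] -/
theorem curveClass_map_refl (c : CurveClass ℂ) :
    CurveClass.map ((Homeomorph.refl ℂ : ℂ ≃ₜ ℂ) : C(ℂ, ℂ)) c = c := by
  obtain ⟨γ, rfl⟩ := CurveClass.surjective_mk c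
  rfl

/-- **`LatticeUniversality → ModulusUniversality`** (registered sub-goal
`modulusUniversality_of_latticeUniversality`): the `Φ = id` case.  With `r₁ = r₂ = 1` the only
admissible `Φ` is the identity; a hexagonal endpoint approximation of `D = D.map Φ.symm` exists, and
(U) gives the merging for it. [folklore] -/
theorem modulusUniversality_of_latticeUniversality :
    Summit.CriticalPhenomena.SAWScalingLimit.Theses.SAWHexUniversality.LatticeUniversality →
    Summit.CriticalPhenomena.SAWScalingLimit.Theses.SAWBrickWallHomotopy.ModulusUniversality := by
  intro hU
  refine ⟨1, 1, one_pos, one_pos, ?_⟩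
  intro Φ hΦ D a b hab
  have hΦeq : Φ = Homeomorph.refl ℂ := by
    refine Homeomorph.ext fun z => ?_
    rw [hΦ, Homeomorph.refl_apply, one_mul, one_mul]
    exact Complex.re_add_im z
  subst hΦeq
  rw [Homeomorph.refl_symm, MarkedDomain.map_refl]
  obtain ⟨a', b', hab'⟩ :=
    Summit.CriticalPhenomena.SAWScalingLimit.Theorems.HexEndpointApprox.exists_isEmbEndpointApprox D
  refine ⟨a', b', hab', fun f => ?_⟩
  simp only [curveClass_map_refl]
  exact hU D a b a' b' hab hab' f

end Summit.CriticalPhenomena.SAWScalingLimit.Cruxes.ModulusUniversality.Birth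

end
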